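import Summits.NavierStokesRegularity.NavierStokesRegularity.Theorems.EfficiencyFloorSharpLuDoeringBudget
import Summits.NavierStokesRegularity.NavierStokesRegularity.Theorems.EfficiencyFloorProductionEfficiencyDecayLuDoeringRung
import Summits.NavierStokesRegularity.NavierStokesRegularity.Theses.EfficiencyFloor
import HarnessLib

/-!
# Route `EfficiencyFloor`, crux `NearMaximiserBoundedAmplification` (stmt-NavierStokesRegularity-25483; the BET NODE of the
# `LerayFloorGap` rung 25164 of `ProductionEfficiencyDecay` 22866): the FREE PART — bounded amplification by `A` holds for
# EVERY late slice on the first `(1 − A⁻²)`-fraction of the would-be blow-up window, unconditionally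

Helper file (`--supports stmt-NavierStokesRegularity-25483 --as helper`). The item asks for `A ≥ 1`, `ε > 0` such that whenever a
slice `u(s)` is `ε`-close to a normalised maximiser, `Z(u(t)) ≤ A·Z(u(s))` on the WHOLE window
`t − s ≤ (64ν³/(27c⋆⁴))·Z(u(s))⁻²` — which is exactly the blow-up time of the comparison ODE `Ż = (27c⋆⁴/(128ν³))Z³` started at
`Z(u(s))`. This file records what the landed sharp cubic law (`SharpLuDoeringBudget`, stmt-25481) already gives, with NO
closeness hypothesis:

* `sq_le_of_cubic_law` (real analysis) — if `Z > 0` on `[t₁,T)` with derivative `≤ K Z³`, then for `t₁ ≤ s ≤ t < T` with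
  `t − s ≤ θ·(2K)⁻¹·Z(s)⁻²` (`0 ≤ θ < 1`): `Z(t)² ≤ (1−θ)⁻¹ Z(s)²` (integrate `d/dt Z⁻² ≥ −2K`, tree: `stub_integrateEfficiency`);
* `amplification_le_on_subwindow` — for the sharp constant `c⋆` and every `A ≥ 1`: along every maximal classical Leray–Hopf
  rapidly-decaying-datum solution there is `t₁ ∈ (0,T)` such that for all `t₁ ≤ s ≤ t < T` with
  `t − s ≤ (1 − A⁻²)·(64ν³/(27c⋆⁴))·Z(u(s))⁻²`: `Z(u(t)) ≤ A·Z(u(s))` (`Z(v) = ∫‖curl v‖²`; late window from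
  `LuDoeringRung.eventually_one_le`).

READING. The open content of stmt-25483 is therefore confined to the LAST `A⁻²`-fraction of the would-be blow-up window (where the
comparison ODE leaves every bounded set): that is where ε-closeness to a maximiser and the transience bet must act. HONEST FRAMING:
elementary consequence of landed statements along a HYPOTHETICAL blow-up; stmt-25483, `LerayFloorGap`, `ProductionEfficiencyDecay`
and Navier–Stokes regularity stay OPEN; no summit statement is proved. [folklore]
-/

-- the problem directory repeats the summit name (`NavierStokesRegularity/NavierStokesRegularity`)
set_option linter.dupNamespace false

noncomputable section

namespace Summit.NavierStokesRegularity.NavierStokesRegularity.Theorems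

namespace NearMaximiserBoundedAmplification

open Set MeasureTheory Filter Topology
open scoped InnerProductSpace ENNReal
open Literature.Analysis.FluidPDE
open Summit.NavierStokesRegularity.NavierStokesRegularity.Theorems.ProductionEfficiencyDecay

/-- **Sub-window amplification from a cubic law.** If `Z > 0` on `[t₁, T)` and `Z` has at every point of `[t₁,T)` a
derivative `D ≤ K·Z³` (`K > 0`), then for `t₁ ≤ s ≤ t < T` with `t − s ≤ θ·(2K)⁻¹·Z(s)⁻²`, `0 ≤ θ < 1`:
`Z(t)² ≤ (1 − θ)⁻¹·Z(s)²`. [folklore] -/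
theorem sq_le_of_cubic_law {Zr : ℝ → ℝ} {t₁ T K θ : ℝ} (hK : 0 < K) (hθ1 : θ < 1)
    (hpos : ∀ t ∈ Ico t₁ T, 0 < Zr t)
    (hder : ∀ t ∈ Ico t₁ T, ∃ D : ℝ, HasDerivAt Zr D t ∧ D ≤ K * Zr t ^ 3)
    {s t : ℝ} (hs : t₁ ≤ s) (hst : s ≤ t) (htT : t < T)
    (hwin : t - s ≤ θ * (2 * K)⁻¹ * (Zr s)⁻¹ ^ 2) :
    Zr t ^ 2 ≤ (1 - θ)⁻¹ * Zr s ^ 2 := by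
  have hint := stub_integrateEfficiency Zr t₁ T K hpos hder s t hs hst htT
  have hZs : 0 < Zr s := hpos s ⟨hs, lt_of_le_of_lt hst htT⟩
  have hZt : 0 < Zr t := hpos t ⟨hs.trans hst, htT⟩
  have h1 : 2 * K * (t - s) ≤ θ * (Zr s)⁻¹ ^ 2 := by
    calc 2 * K * (t - s) ≤ 2 * K * (θ * (2 * K)⁻¹ * (Zr s)⁻¹ ^ 2) :=
          mul_le_mul_of_nonneg_left hwin (by positivity)
      _ = θ * (Zr s)⁻¹ ^ 2 := by field_simp
  have h2 : (1 - θ) * (Zr s)⁻¹ ^ 2 ≤ (Zr t)⁻¹ ^ 2 := by linarith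
  have hZs2 : 0 < Zr s ^ 2 := by positivity
  have hZt2 : 0 < Zr t ^ 2 := by positivity
  have h3 : (1 - θ) * Zr t ^ 2 ≤ Zr s ^ 2 := by
    rw [inv_pow, inv_pow, ← div_eq_mul_inv, div_le_iff₀ hZs2, ← div_eq_inv_mul, le_div_iff₀ hZt2] at h2
    exact h2
  have h1θ : 0 < 1 - θ := by linarith
  rw [← div_eq_inv_mul, le_div_iff₀ h1θ]
  linarith

/-- **THE FREE PART OF stmt-25483: amplification `≤ A` on the first `(1 − A⁻²)`-fraction of the would-be blow-up window,
for every late slice.** For the sharp one-sided Lu–Doering constant `c⋆` (same clause as in the route decls) and every `A ≥ 1`: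
along every maximal classical solution on `[0,T)` that is Leray–Hopf from a rapidly decaying datum there is `t₁ ∈ (0,T)` such that
for all `s ∈ [t₁,T)`, `t ∈ [s,T)` with `t − s ≤ (1 − (A²)⁻¹)·(64ν³/(27c⋆⁴))·(∫‖curl u(s)‖²)⁻²`:
`∫‖curl u(t)‖² ≤ A·∫‖curl u(s)‖²`. No closeness to a maximiser is assumed. [folklore] -/
theorem amplification_le_on_subwindow :
    ∃ c : ℝ, (0 < c ∧ (∀ v : EuclideanSpace ℝ (Fin 3) → EuclideanSpace ℝ (Fin 3), (ContDiff ℝ (⊤ : ℕ∞) v ∧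
      Literature.Analysis.FluidPDE.VectorCalculus.IsDivFree v ∧ (∫⁻ x, ‖iteratedFDeriv ℝ 0 v x‖ₑ ^ 2 < ⊤) ∧
      (∫⁻ x, ‖iteratedFDeriv ℝ 1 v x‖ₑ ^ 2 < ⊤) ∧ (∫⁻ x, ‖iteratedFDeriv ℝ 2 v x‖ₑ ^ 2 < ⊤)) → (∫ x,
      ⟪Literature.Analysis.FluidPDE.curl v x, fderiv ℝ v x (Literature.Analysis.FluidPDE.curl v x)⟫_ℝ) ≤ c *
      (∫ x, ‖Literature.Analysis.FluidPDE.curl v x‖ ^ 2) ^ (3 / 4 : ℝ) * (∫ x,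
      Literature.Analysis.FluidPDE.frobeniusNormSq (fderiv ℝ (Literature.Analysis.FluidPDE.curl v) x)) ^ (3 /
      4 : ℝ)) ∧ ∀ c' : ℝ, (∀ w : EuclideanSpace ℝ (Fin 3) → EuclideanSpace ℝ (Fin 3), (ContDiff ℝ (⊤ : ℕ∞) w ∧
      Literature.Analysis.FluidPDE.VectorCalculus.IsDivFree w ∧ (∫⁻ x, ‖iteratedFDeriv ℝ 0 w x‖ₑ ^ 2 < ⊤) ∧
      (∫⁻ x, ‖iteratedFDeriv ℝ 1 w x‖ₑ ^ 2 < ⊤) ∧ (∫⁻ x, ‖iteratedFDeriv ℝ 2 w x‖ₑ ^ 2 < ⊤)) → (∫ x,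
      ⟪Literature.Analysis.FluidPDE.curl w x, fderiv ℝ w x (Literature.Analysis.FluidPDE.curl w x)⟫_ℝ) ≤ c' *
      (∫ x, ‖Literature.Analysis.FluidPDE.curl w x‖ ^ 2) ^ (3 / 4 : ℝ) * (∫ x,
      Literature.Analysis.FluidPDE.frobeniusNormSq (fderiv ℝ (Literature.Analysis.FluidPDE.curl w) x)) ^ (3 /
      4 : ℝ)) → c ≤ c') ∧
      ∀ A : ℝ, 1 ≤ A → ∀ (ν T : ℝ), 0 < ν → 0 < T →
        ∀ (u : ℝ → EuclideanSpace ℝ (Fin 3) → EuclideanSpace ℝ (Fin 3))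
          (p : ℝ → EuclideanSpace ℝ (Fin 3) → ℝ),
        IsMaximalSmoothSolution ν 0 u p T → IsLerayHopfOn T ν 0 (u 0) u → HasRapidSpatialDecay (u 0) →
        ∃ t₁ ∈ Ioo 0 T, ∀ s ∈ Ico t₁ T, ∀ t ∈ Ico s T,
          t - s ≤ (1 - (A ^ 2)⁻¹) * (64 * ν ^ 3 / (27 * c ^ 4)) * (∫ x, ‖curl (u s) x‖ ^ 2)⁻¹ ^ 2 →
          (∫ x, ‖curl (u t) x‖ ^ 2) ≤ A * (∫ x, ‖curl (u s) x‖ ^ 2) := by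
  obtain ⟨c, hsharp, hbud⟩ := efficiencyFloor_sharpLuDoeringBudget_proof
  refine ⟨c, hsharp, fun A hA ν T hν hT u p hmax hLH hdec => ?_⟩
  have hc : 0 < c := hsharp.1
  obtain ⟨Zr, D, hZD⟩ := hbud ν T hν hT u p hmax hLH hdec
  obtain ⟨t₁, ht₁, hone⟩ := LuDoeringRung.eventually_one_le hν hT hmax hLH hdec (Zr := Zr)
    (fun t ht => (hZD t ht).1)
  refine ⟨t₁, ht₁, fun s hs t ht hwin => ?_⟩
  have hsI : s ∈ Ioo 0 T := ⟨ht₁.1.trans_le hs.1, hs.2⟩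
  have htI : t ∈ Ioo 0 T := ⟨hsI.1.trans_le ht.1, ht.2⟩
  set K : ℝ := 27 * c ^ 4 / (128 * ν ^ 3) with hK
  have hKpos : 0 < K := by positivity
  have hpos : ∀ τ ∈ Ico t₁ T, 0 < Zr τ := fun τ hτ => lt_of_lt_of_le one_pos (hone τ hτ)
  have hder : ∀ τ ∈ Ico t₁ T, ∃ D' : ℝ, HasDerivAt Zr D' τ ∧ D' ≤ K * Zr τ ^ 3 := fun τ hτ =>
    ⟨D τ, (hZD τ ⟨ht₁.1.trans_le hτ.1, hτ.2⟩).2.2.2.2.1, (hZD τ ⟨ht₁.1.trans_le hτ.1, hτ.2⟩).2.2.2.2.2.2⟩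
  -- the slices' enstrophies are `Zr s`, `Zr t`
  have hZs : (∫ x, ‖curl (u s) x‖ ^ 2) = Zr s := ((hZD s hsI).2.2.2.1).symm
  have hZt : (∫ x, ‖curl (u t) x‖ ^ 2) = Zr t := ((hZD t htI).2.2.2.1).symm
  rw [hZs] at hwin
  rw [hZs, hZt]
  -- the window fraction `θ = 1 − A⁻²`
  have hA0 : 0 < A := lt_of_lt_of_le one_pos hA
  have hA2 : 1 ≤ A ^ 2 := by nlinarith
  have hθ1 : 1 - (A ^ 2)⁻¹ < 1 := by
    have : 0 < (A ^ 2)⁻¹ := by positivity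
    linarith
  have hwin' : t - s ≤ (1 - (A ^ 2)⁻¹) * (2 * K)⁻¹ * (Zr s)⁻¹ ^ 2 := by
    have he : (2 * K)⁻¹ = 64 * ν ^ 3 / (27 * c ^ 4) := by
      rw [hK]; field_simp; norm_num
    rw [he]; exact hwin
  have hsq := sq_le_of_cubic_law hKpos hθ1 hpos hder hs.1 ht.1 ht.2 hwin'
  have h1θ : (1 - (1 - (A ^ 2)⁻¹))⁻¹ = A ^ 2 := by
    rw [sub_sub_cancel, inv_inv]
  rw [h1θ, ← mul_pow] at hsq
  have hZt0 : 0 ≤ Zr t := (hpos t ⟨hs.1.trans ht.1, ht.2⟩).le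
  have hAZ : 0 ≤ A * Zr s := mul_nonneg hA0.le (hpos s hs).le
  exact (pow_le_pow_iff_left₀ hZt0 hAZ two_ne_zero).1 hsq

end NearMaximiserBoundedAmplification

end Summit.NavierStokesRegularity.NavierStokesRegularity.Theorems

end
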